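import Mathlib
import HarnessLib
import Summits.Ventures.LatticeQCDFlow.Exactness.FlowPushforward
import Summits.Ventures.LatticeQCDFlow.Exactness.ClassSweep
import Summits.Ventures.LatticeQCDFlow.Exactness.CheckerboardSweep
import Summits.Ventures.LatticeQCDFlow.Scaling.EntropyBudgetCoupling

/-!
# The sequential one-site-at-a-time loop over a class-ordered site list is a composition of coupling layers, so its exact Jacobian is the product of the per-site factors along the loop

HONEST FRAMING: exact (Metropolis-corrected) sampling algorithms for lattice gauge theory;
figures of merit are autocorrelation/cost numbers at stated couplings and volumes; no
continuum-physics claim.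

Venture `LatticeQCDFlow` (cell pub-lqcd), topic `Exactness`; FANOUT row 7 (`s0-cpn-null`: the
S0-D1 rung — 2D CP⁹, Lüscher's leading-order trivializing map inside HMC, Engel–Schaefer 2011).
NEW WORK of the cell: a BRIDGE between three of the tree's own files —
`Exactness/ClassSweep.lean` (row 9: `siteUpdate`, `classUpdate c u` = the simultaneous update of
the sites listed in `c`, `sweepInOrder c u` = the sequential loop through `c`, `ReadsOnly`,
`ClassIndep`, `sweepInOrder_eq_classUpdate`), `Scaling/EntropyBudgetCoupling.lean` (theory seat:
the coupling layer `Theory2.coupleFun p ψ` with exact Jacobian `Theory2.coupleJac p j`,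
`Theory2.hasJacobian_coupleFun`) and `Exactness/CheckerboardSweep.lean` (row 7: two classes in
turn, `sweepJac`, `hasJacobian_sweep`, THMC exact).  Nothing is cited as a fact.  Printed
counterpart, NAMED ONLY: Engel–Schaefer, Comput. Phys. Commun. 182 (2011) 2107, §3 (the LO map
applied "sweeping through the lattice"; `S_eff = S(F(y)) − Σ_n ln det 𝒥_n`).

## Why this file

Row 7's production kernel (like the cell's reference implementation) realises the field
transformation as ONE sequential loop over a class-ordered site list — all even sites, then all
odd sites — each visit rewriting one site from the CURRENT configuration and adding that site's
`ln det 𝒥_n` to a running sum.  `ClassSweep.lean` says such a loop equals the class-by-class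
simultaneous update when same-class sites do not read each other; `EntropyBudgetCoupling.lean`
says a simultaneous class update whose single-site maps read only the OTHER sites is a coupling
layer with exact Jacobian = the product of the single-site Jacobians; `CheckerboardSweep.lean`
composes two classes.  This file joins them: the loop AS RUN has exact Jacobian `sweepJac` = the
exponential of the code's running sum.

## Content (`ι` sites with decidable equality, site space `G`; a rule family
## `u : ι → (ι → G) → G`; a class `p` whose rules have the coupling form
## `u k x = ψ ⟨k, _⟩ (x|_{¬p}) (x k)` — they read the frozen sites and the site itself only)

* `classUpdate_eq_coupleFun` — the simultaneous update of a list `c` of exactly the `p`-sites IS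
  `coupleFun p ψ`; `readsOnly_of_couple`, `classIndep_of_couple` — coupling-form rules read only
  `{frozen} ∪ {self}`, so every duplicate-free list of `p`-sites is an independent class;
  **`sweepInOrder_eq_coupleFun`** — hence the sequential loop through the class, in any
  duplicate-free order, IS `coupleFun p ψ` (`ClassSweep.sweepInOrder_eq_classUpdate`).
* **`hasJacobian_sweepInOrder`** — the loop through one class has exact Jacobian `coupleJac p j`
  (= `∏_a j a (x|frozen) (x a)`, each factor computable at the moment of the visit) w.r.t. `⊗ᵢ m`.
* **`hasJacobian_sweepInOrder_append`** — the loop through `c₁ ++ c₂` (class `p`, then class `q`,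
  the same rule family `u` having the coupling form for both — for a nearest-neighbour local field
  and the two parity classes: automatically) has exact Jacobian
  `CheckerboardSweep.sweepJac p q ψ₁ j₁ j₂` — the `q`-factors evaluated on the configuration the
  `p`-loop left behind; its logarithm is the code's running sum (`CheckerboardSweep.log_sweepJac`),
  and THMC with it is exact (`CheckerboardSweep.thmc_sweep_exact`).

NOT CLAIMED: loops in which a visit reads a not-yet-frozen site of its own class (lexicographic
order with nearest neighbours: a different triangular map, see `ClassSweep`'s counterexample);
the sphere-level single-site Jacobian (hypothesis `hJ`); autocorrelations.
-/

namespace Summit.Ventures.LatticeQCDFlow.Exactness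

open MeasureTheory Summit.Ventures.LatticeQCDFlow.Theory2
open scoped ENNReal

variable {ι : Type*} [DecidableEq ι] {p : ι → Prop} [DecidablePred p] {G : Type*}

/-! ## Coupling-form rules: the class update is the coupling layer -/

/-- **Simultaneous class update = coupling layer.**  If `c` lists exactly the `p`-sites and the rule
at every `p`-site has the coupling form `u k x = ψ ⟨k, _⟩ (x|frozen) (x k)`, then
`classUpdate c u = coupleFun p ψ`. -/
theorem classUpdate_eq_coupleFun {u : ι → (ι → G) → G}
    {ψ : {i // p i} → ({i // ¬p i} → G) → G → G} {c : List ι} (hmem : ∀ k, k ∈ c ↔ p k)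
    (hu : ∀ (k : ι) (hk : p k) (x : ι → G), u k x = ψ ⟨k, hk⟩ (fun f => x f) (x k)) :
    classUpdate c u = coupleFun p ψ := by
  funext x k
  rw [classUpdate_apply]
  by_cases hk : p k
  · rw [if_pos ((hmem k).2 hk), coupleFun_apply_of_pos _ _ hk, hu k hk]
  · rw [if_neg (fun h => hk ((hmem k).1 h)), coupleFun_apply_of_neg _ _ hk]

omit [DecidableEq ι] [DecidablePred p] in
/-- A coupling-form rule at the active site `k` reads only the frozen sites and `k` itself. -/
theorem readsOnly_of_couple {u : ι → (ι → G) → G} {ψ : {i // p i} → ({i // ¬p i} → G) → G → G}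
    {k : ι} (hk : p k) (hu : ∀ x : ι → G, u k x = ψ ⟨k, hk⟩ (fun f => x f) (x k)) :
    ReadsOnly (u k) ({i | ¬p i} ∪ {k}) := by
  intro x y hxy
  rw [hu x, hu y, hxy k (Or.inr rfl)]
  congr 1
  funext f
  exact hxy f (Or.inl f.2)

/-- The stencil assignment used below: frozen sites plus self at active sites, everything at
inactive sites (whose rules never run inside the class). -/
def coupleStencil (p : ι → Prop) (k : ι) : Set ι := {i | ¬p i} ∪ {k}

omit [DecidableEq ι] in
/-- Every rule reads only its `coupleStencil` (active sites: by the coupling form; inactive sites: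
we enlarge the stencil to everything, which `ReadsOnly` allows). -/
theorem readsOnly_coupleStencil {u : ι → (ι → G) → G}
    {ψ : {i // p i} → ({i // ¬p i} → G) → G → G}
    (hu : ∀ (k : ι) (hk : p k) (x : ι → G), u k x = ψ ⟨k, hk⟩ (fun f => x f) (x k)) (k : ι) :
    ReadsOnly (u k) (if p k then coupleStencil p k else Set.univ) := by
  by_cases hk : p k
  · rw [if_pos hk]
    exact readsOnly_of_couple hk (hu k hk)
  · rw [if_neg hk]
    intro x y hxy
    have : x = y := funext fun i => hxy i (Set.mem_univ i)
    rw [this]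

omit [DecidableEq ι] in
/-- **A duplicate-free list of `p`-sites is an independent class** for these stencils: another
listed site is active and different, hence outside `{frozen} ∪ {self}`. -/
theorem classIndep_of_couple {c : List ι} (hc : c.Nodup) (hmem : ∀ k, k ∈ c → p k) :
    ClassIndep (fun k => if p k then coupleStencil p k else Set.univ) c := by
  refine ⟨hc, fun i hi j hj hij => ?_⟩
  show j ∉ (if p i then coupleStencil p i else Set.univ)
  rw [if_pos (hmem i hi)]
  rintro (h | h)
  · exact h (hmem j hj)
  · exact hij (Set.mem_singleton_iff.1 h).symm

/-- **The sequential loop through a class IS the coupling layer.**  For a duplicate-free list `c`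
of exactly the `p`-sites and coupling-form rules, `sweepInOrder c u x = coupleFun p ψ x` — in
particular the visiting order inside the class is immaterial. -/
theorem sweepInOrder_eq_coupleFun {u : ι → (ι → G) → G}
    {ψ : {i // p i} → ({i // ¬p i} → G) → G → G} {c : List ι} (hc : c.Nodup)
    (hmem : ∀ k, k ∈ c ↔ p k)
    (hu : ∀ (k : ι) (hk : p k) (x : ι → G), u k x = ψ ⟨k, hk⟩ (fun f => x f) (x k)) (x : ι → G) :
    sweepInOrder c u x = coupleFun p ψ x := by
  rw [sweepInOrder_eq_classUpdate (readsOnly_coupleStencil hu)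
    (classIndep_of_couple hc fun k hk => (hmem k).1 hk), classUpdate_eq_coupleFun hmem hu]

/-! ## Jacobians of the loops -/

section Jacobian

variable [Fintype ι] [MeasurableSpace G] (m : Measure G) [SigmaFinite m]

/-- **The loop through one class has exact Jacobian = the product of the per-site factors**
(`Theory2.hasJacobian_coupleFun` along `sweepInOrder_eq_coupleFun`). -/
theorem hasJacobian_sweepInOrder {u : ι → (ι → G) → G}
    {ψ : {i // p i} → ({i // ¬p i} → G) → G → G} {j : {i // p i} → ({i // ¬p i} → G) → G → ℝ}
    {c : List ι} (hc : c.Nodup) (hmem : ∀ k, k ∈ c ↔ p k)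
    (hu : ∀ (k : ι) (hk : p k) (x : ι → G), u k x = ψ ⟨k, hk⟩ (fun f => x f) (x k))
    (hψ : ∀ a, Measurable fun z : G × ({i // ¬p i} → G) => ψ a z.2 z.1)
    (hj : ∀ a, Measurable fun z : G × ({i // ¬p i} → G) => j a z.2 z.1)
    (hJ : ∀ a y, HasJacobian m (ψ a y) fun g => ENNReal.ofReal (j a y g))
    (hj0 : ∀ a y g, 0 ≤ j a y g) :
    HasJacobian (Measure.pi fun _ : ι => m) (sweepInOrder c u)
      fun x => ENNReal.ofReal (coupleJac p j x) := by
  have h : sweepInOrder c u = coupleFun p ψ := funext (sweepInOrder_eq_coupleFun hc hmem hu)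
  rw [h]
  exact hasJacobian_coupleFun m hψ hj hJ hj0

variable {q : ι → Prop} [DecidablePred q]

/-- **The loop over a class-ordered site list `c₁ ++ c₂` (class `p`, then class `q`) has exact
Jacobian `sweepJac`**: the `q`-factors are evaluated on the configuration left by the `p`-loop
(local fields recomputed), the `p`-factors on the initial one — the exponential of the code's
running sum of `ln det 𝒥_n` (`CheckerboardSweep.log_sweepJac`); THMC with this map is exact by
`CheckerboardSweep.thmc_sweep_exact`.  The same rule family `u` must have the coupling form for
both classes (checkerboard with nearest-neighbour local fields: it does). -/
theorem hasJacobian_sweepInOrder_append {u : ι → (ι → G) → G}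
    {ψ₁ : {i // p i} → ({i // ¬p i} → G) → G → G} {j₁ : {i // p i} → ({i // ¬p i} → G) → G → ℝ}
    {ψ₂ : {i // q i} → ({i // ¬q i} → G) → G → G} {j₂ : {i // q i} → ({i // ¬q i} → G) → G → ℝ}
    {c₁ c₂ : List ι} (hc₁ : c₁.Nodup) (hmem₁ : ∀ k, k ∈ c₁ ↔ p k) (hc₂ : c₂.Nodup)
    (hmem₂ : ∀ k, k ∈ c₂ ↔ q k)
    (hu₁ : ∀ (k : ι) (hk : p k) (x : ι → G), u k x = ψ₁ ⟨k, hk⟩ (fun f => x f) (x k))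
    (hu₂ : ∀ (k : ι) (hk : q k) (x : ι → G), u k x = ψ₂ ⟨k, hk⟩ (fun f => x f) (x k))
    (hψ₁ : ∀ a, Measurable fun z : G × ({i // ¬p i} → G) => ψ₁ a z.2 z.1)
    (hj₁ : ∀ a, Measurable fun z : G × ({i // ¬p i} → G) => j₁ a z.2 z.1)
    (hJ₁ : ∀ a y, HasJacobian m (ψ₁ a y) fun g => ENNReal.ofReal (j₁ a y g))
    (hj₁0 : ∀ a y g, 0 ≤ j₁ a y g)
    (hψ₂ : ∀ a, Measurable fun z : G × ({i // ¬q i} → G) => ψ₂ a z.2 z.1)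
    (hj₂ : ∀ a, Measurable fun z : G × ({i // ¬q i} → G) => j₂ a z.2 z.1)
    (hJ₂ : ∀ a y, HasJacobian m (ψ₂ a y) fun g => ENNReal.ofReal (j₂ a y g))
    (hj₂0 : ∀ a y g, 0 ≤ j₂ a y g) :
    HasJacobian (Measure.pi fun _ : ι => m) (sweepInOrder (c₁ ++ c₂) u)
      fun x => ENNReal.ofReal (sweepJac p q ψ₁ j₁ j₂ x) := by
  have h : sweepInOrder (c₁ ++ c₂) u = coupleFun q ψ₂ ∘ coupleFun p ψ₁ := by
    funext x
    rw [sweepInOrder_append, sweepInOrder_eq_coupleFun hc₁ hmem₁ hu₁,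
      sweepInOrder_eq_coupleFun hc₂ hmem₂ hu₂, Function.comp_apply]
  rw [h]
  exact hasJacobian_sweep m hψ₁ hj₁ hJ₁ hj₁0 hψ₂ hj₂ hJ₂ hj₂0

end Jacobian

end Summit.Ventures.LatticeQCDFlow.Exactness
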